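import Mathlib
import HarnessLib.Audit
import Summits.PneNP.PneNP.Theorems.PstarGateCasePUnitsCommon
import Summits.PneNP.PneNP.Theorems.PstarGateUnitCycleRankSix
import Summits.PneNP.PneNP.Theorems.PstarChordBridgeNor

/-!
# One GATED chord, CASE P with one EXC-unit chord: at most four core outputs (E2 node N2X, unit branch; prover-1 g21)

FRONTIER range-avoidance ladder, rung F-N3 (`stmt-PneNP-19007`), cell `pnp-ideate` (`PstarGateNodesX.GateCasePUnitsX`); restricted-model proof
complexity — nothing here bears on `P` versus `NP`.

One-gate data on an XOR-closed core, CASE P, `N = {e, e'}` with `e'` an EXC-unit w.r.t. `q = q_{(1,0)}` (`UnitCert`: `D e' = {j₁, j₂}`, disjoint AND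
pairs, literals `σ ∈ j₁`, `τ ∈ j₂`, polar formula `polarDir (1,0) (e_v, e_w) = [v ~ w in D e'] + [{v,w} = {σ,τ}]`).  From the polar formula:
`q` has rank `≥ 4` (the hyperbolic pairs `(e_{σ'}, e_σ)`, `(e_{τ'}, e_τ + e_{σ'})`; `finrank_rad_add_four_le`), the gadget `(σ, τ)` is realised in
`T₁ ∪ freeMon G₁ ∪ T₂ ∪ freeMon G₂` (`exists_realiser_of_polarDir`), and an AND variable avoiding `D e'` is invisible to the polar form.  With
(P1) `Z(q) ⊆ {Q_{D e'} = γ' + 1}` (`caseP_forced`) and (P3) (`caseP_P3`): a tree edge private within the counted family is far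
(`false_of_private_far`) or one of `j₁, j₂`, touched by the gadget (`false_of_private_pair`); so the budget gives

* `caseP_unit_card_le` — **CASE P with `N − e = {e'}`, `e'` an EXC-unit: `#J₀ ≤ 5`** (indeed `≤ 4`).
-/

set_option linter.dupNamespace false -- `Summit.PneNP.PneNP.…`: summit = sub-problem name (D-0017 single-conjunct layout)

open Finset Module Literature.Computability.Complexity
open Summit.PneNP.PneNP.Theorems.PstarTyped (Typed)
open Summit.PneNP.PneNP.Theorems.PstarSALevel (varSet BoundaryExpanding SimpleOverlap)
open Summit.PneNP.PneNP.Theorems.PstarGapLinearised (andPair andPair_subset_varSet)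
open Summit.PneNP.PneNP.Theorems.PstarChordEndgameTools (mem_andPair_iff)
open Summit.PneNP.PneNP.Theorems.PstarCentreFree (vars_mem_varSet)
open Summit.PneNP.PneNP.Theorems.PstarQuadRank (rad mem_rad)
open Summit.PneNP.PneNP.Theorems.PstarProductRank (qform polar)
open Summit.PneNP.PneNP.Theorems.PstarPathRank (AndAdj polar_basis and_ne)
open Summit.PneNP.PneNP.Theorems.PstarReadSumset (V2)
open Summit.PneNP.PneNP.Theorems.PstarChordSystem (ChordSystem)
open Summit.PneNP.PneNP.Theorems.PstarChordBridgeTools (privs coef vars_mem_privs)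
open Summit.PneNP.PneNP.Theorems.PstarChordBridge (BridgeData sys Solution Lift)
open Summit.PneNP.PneNP.Theorems.PstarChordBridgeForcing (gam freeMon)
open Summit.PneNP.PneNP.Theorems.PstarChordBridgeBasis (qDir polarDir)
open Summit.PneNP.PneNP.Theorems.PstarChordBridgeCorner (andAdj_iff_mem)
open Summit.PneNP.PneNP.Theorems.PstarChordBridgeFundamental (two_le_card_of_even)
open Summit.PneNP.PneNP.Theorems.PstarChordBridgeNor (polarDir_self polarDir_comm)
open Summit.PneNP.PneNP.Theorems.PstarNorUnitMixed (ne_of_unit)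
open Summit.PneNP.PneNP.Theorems.PstarNorUnitCases (andPair_eq_of_mem mem_of_andAdj)
open Summit.PneNP.PneNP.Theorems.PstarNorUnitDir (exists_realiser_of_polarDir)
open Summit.PneNP.PneNP.Theorems.PstarGateBridge (GateHyp caseP_forced)
open Summit.PneNP.PneNP.Theorems.PstarGateCasePRegimes (UnitCert)
open Summit.PneNP.PneNP.Theorems.PstarGateNodes (GateData ReadAlong AllRead)
open Summit.PneNP.PneNP.Theorems.PstarGateNodesX (GateDataX)
open Summit.PneNP.PneNP.Theorems.PstarGateUnitCycleRankSix (finrank_sup_pair_add_two_le orth_sup_pair)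
open Summit.PneNP.PneNP.Theorems.PstarGateCasePUnitsCommon

namespace Summit.PneNP.PneNP.Theorems.PstarGateCasePUnitsUnit

/-! ## Model: two orthogonal hyperbolic pairs -/

section Model

variable {M : Type*} [AddCommGroup M] [Module (ZMod 2) M]

/-- **Two orthogonal hyperbolic pairs: the radical has codimension at least four.** -/
theorem finrank_rad_add_four_le [FiniteDimensional (ZMod 2) M] {B : LinearMap.BilinForm (ZMod 2) M} (halt : ∀ x, B x x = 0)
    (hsymm : ∀ x y, B x y = B y x) {a₁ b₁ a₂ b₂ : M} (h₁ : B a₁ b₁ ≠ 0) (h₂ : B a₂ b₂ ≠ 0)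
    (h12 : B a₁ a₂ = 0 ∧ B a₁ b₂ = 0 ∧ B b₁ a₂ = 0 ∧ B b₁ b₂ = 0) :
    finrank (ZMod 2) (rad B) + 4 ≤ finrank (ZMod 2) M := by
  set R₀ := rad B with hR₀def
  set R₁ := R₀ ⊔ (ZMod 2) ∙ a₁ ⊔ (ZMod 2) ∙ b₁ with hR₁def
  set R₂ := R₁ ⊔ (ZMod 2) ∙ a₂ ⊔ (ZMod 2) ∙ b₂ with hR₂def
  have hR₀ : ∀ x, ∀ r ∈ R₀, B r x = 0 := fun x r hr => mem_rad.1 hr x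
  have s1 : finrank (ZMod 2) R₀ + 2 ≤ finrank (ZMod 2) R₁ := finrank_sup_pair_add_two_le hsymm R₀ h₁ (halt a₁) (hR₀ b₁) (hR₀ a₁)
  have hR₁a₂ : ∀ r ∈ R₁, B r a₂ = 0 := orth_sup_pair R₀ (hR₀ a₂) h12.1 h12.2.2.1
  have hR₁b₂ : ∀ r ∈ R₁, B r b₂ = 0 := orth_sup_pair R₀ (hR₀ b₂) h12.2.1 h12.2.2.2
  have s2 : finrank (ZMod 2) R₁ + 2 ≤ finrank (ZMod 2) R₂ := finrank_sup_pair_add_two_le hsymm R₁ h₂ (halt a₂) hR₁b₂ hR₁a₂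
  have d : finrank (ZMod 2) R₂ ≤ finrank (ZMod 2) M := Submodule.finrank_le _
  omega

end Model

variable {n m : ℕ}

/-! ## The unit's polar formula: rank four, far variables, the gadget -/

/-- No AND-adjacency in a CONS-T pair between a variable of `j₁` and a variable of `j₂`. -/
theorem not_andAdj_cross (I : LocalMap 4 n m) {j₁ j₂ : Fin m} {v w : Fin n} (hdisj : Disjoint (andPair I j₁) (andPair I j₂))
    (hv : v ∈ andPair I j₁) (hw : w ∈ andPair I j₂) : ¬ AndAdj I ({j₁, j₂} : Finset (Fin m)) v w := by
  intro h
  obtain ⟨j, hj, hvj, hwj⟩ := mem_of_andAdj h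
  rw [mem_insert, mem_singleton] at hj
  rcases hj with rfl | rfl
  · exact Finset.disjoint_left.1 hdisj hwj hw
  · exact Finset.disjoint_left.1 hdisj hv hvj

/-- **The CONS-T polar formula has rank at least four.** -/
theorem rank_four_of_unitCert (I : LocalMap 4 n m) (hI : I.IsPure xorAndPred) (B : BridgeData n m)
    {j₁ j₂ : Fin m} {σ τ : Fin n} (hdisj : Disjoint (andPair I j₁) (andPair I j₂)) (hσ : σ ∈ andPair I j₁) (hτ : τ ∈ andPair I j₂)
    (hform : ∀ v w : Fin n, polarDir I B (1, 0) (Pi.single v 1) (Pi.single w 1) =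
      (if AndAdj I ({j₁, j₂} : Finset (Fin m)) v w then 1 else 0) + (if (v = σ ∧ w = τ) ∨ (v = τ ∧ w = σ) then 1 else 0)) :
    finrank (ZMod 2) (rad (polarDir I B (1, 0))) + 4 ≤ finrank (ZMod 2) (Fin n → ZMod 2) := by
  classical
  set P := polarDir I B (1, 0) with hP
  have hστ : σ ≠ τ := ne_of_unit I hdisj hσ hτ
  -- the mates `σ'`, `τ'`
  obtain ⟨σ', hσ', hσσ', hA₁⟩ : ∃ σ', σ' ∈ andPair I j₁ ∧ σ' ≠ σ ∧ AndAdj I ({j₁, j₂} : Finset (Fin m)) σ' σ := by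
    have hj₁ : j₁ ∈ ({j₁, j₂} : Finset (Fin m)) := mem_insert_self _ _
    rcases (mem_andPair_iff I j₁ σ).1 hσ with h | h
    · refine ⟨I.vars j₁ 3, (mem_andPair_iff I j₁ _).2 (Or.inr rfl), fun h' => and_ne I hI j₁ (h.symm ▸ h'.symm), ⟨j₁, hj₁, Or.inr ⟨h.symm, rfl⟩⟩⟩
    · refine ⟨I.vars j₁ 2, (mem_andPair_iff I j₁ _).2 (Or.inl rfl), fun h' => and_ne I hI j₁ (h'.trans h), ⟨j₁, hj₁, Or.inl ⟨rfl, h.symm⟩⟩⟩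
  obtain ⟨τ', hτ', hττ', hA₂⟩ : ∃ τ', τ' ∈ andPair I j₂ ∧ τ' ≠ τ ∧ AndAdj I ({j₁, j₂} : Finset (Fin m)) τ' τ := by
    have hj₂ : j₂ ∈ ({j₁, j₂} : Finset (Fin m)) := mem_insert_of_mem (mem_singleton_self _)
    rcases (mem_andPair_iff I j₂ τ).1 hτ with h | h
    · refine ⟨I.vars j₂ 3, (mem_andPair_iff I j₂ _).2 (Or.inr rfl), fun h' => and_ne I hI j₂ (h.symm ▸ h'.symm), ⟨j₂, hj₂, Or.inr ⟨h.symm, rfl⟩⟩⟩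
    · refine ⟨I.vars j₂ 2, (mem_andPair_iff I j₂ _).2 (Or.inl rfl), fun h' => and_ne I hI j₂ (h'.trans h), ⟨j₂, hj₂, Or.inl ⟨rfl, h.symm⟩⟩⟩
  have hσ'τ : σ' ≠ τ := fun h => Finset.disjoint_left.1 hdisj hσ' (h ▸ hτ)
  have hτ'σ : τ' ≠ σ := fun h => Finset.disjoint_left.1 hdisj (h ▸ hσ) hτ'
  -- the six values
  have v1 : P (Pi.single σ' 1) (Pi.single σ 1) = 1 := by
    rw [hP, hform, if_pos hA₁, if_neg]; · decide
    rintro (⟨h, -⟩ | ⟨h, -⟩); exacts [hσσ' h, hσ'τ h]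
  have v2 : P (Pi.single τ' 1) (Pi.single τ 1) = 1 := by
    rw [hP, hform, if_pos hA₂, if_neg]; · decide
    rintro (⟨h, -⟩ | ⟨h, -⟩); exacts [hτ'σ h, hττ' h]
  have v3 : P (Pi.single σ' 1) (Pi.single τ' 1) = 0 := by
    rw [hP, hform, if_neg (not_andAdj_cross I hdisj hσ' hτ'), if_neg]; · decide
    rintro (⟨h, -⟩ | ⟨h, -⟩); exacts [hσσ' h, hσ'τ h]
  have v4 : P (Pi.single σ' 1) (Pi.single τ 1) = 0 := by
    rw [hP, hform, if_neg (not_andAdj_cross I hdisj hσ' hτ), if_neg]; · decide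
    rintro (⟨h, -⟩ | ⟨h, -⟩); exacts [hσσ' h, hσ'τ h]
  have v5 : P (Pi.single σ 1) (Pi.single τ' 1) = 0 := by
    rw [hP, hform, if_neg (not_andAdj_cross I hdisj hσ hτ'), if_neg]; · decide
    rintro (⟨-, h⟩ | ⟨h, -⟩); exacts [hττ' h, hστ h]
  have v6 : P (Pi.single σ 1) (Pi.single τ 1) = 1 := by
    rw [hP, hform, if_neg (not_andAdj_cross I hdisj hσ hτ), if_pos (Or.inl ⟨rfl, rfl⟩)]; decide
  have v7 : P (Pi.single σ 1) (Pi.single σ' 1) = 1 := by rw [hP, polarDir_comm, ← hP, v1]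
  have v8 : P (Pi.single σ' 1) (Pi.single σ' 1) = 0 := by rw [hP, polarDir_self]
  -- the two hyperbolic pairs `(e_{σ'}, e_σ)`, `(e_{τ'}, e_τ + e_{σ'})`
  refine finrank_rad_add_four_le (fun x => by rw [hP, polarDir_self]) (fun x y => by rw [hP, polarDir_comm])
    (a₁ := Pi.single σ' 1) (b₁ := Pi.single σ 1) (a₂ := Pi.single τ' 1) (b₂ := Pi.single τ 1 + Pi.single σ' 1) ?_ ?_ ⟨v3, ?_, v5, ?_⟩
  · rw [v1]; exact one_ne_zero
  · rw [map_add, v2, hP, polarDir_comm, ← hP, v3, add_zero]; exact one_ne_zero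
  · rw [map_add, v4, v8, add_zero]
  · rw [map_add, v6, v7]; decide

/-- **CASE P with one EXC-unit chord: `#J₀ ≤ 5`.**  See the module docstring. -/
theorem caseP_unit_card_le (I : LocalMap 4 n m) (hI : I.IsPure xorAndPred) (hT : Typed I) (hS : SimpleOverlap I) {r : ℕ}
    (hB : BoundaryExpanding r I) {B : BridgeData n m} {e g₀ : Fin m} {u : Fin n} {κ₀ : ZMod 2} (hD : GateDataX I r B e g₀ u κ₀)
    (hRA : ReadAlong I B e (1, 0)) (hread : AllRead I B e) {e' : Fin m} (hNe : B.N.erase e = {e'}) (hU : UnitCert I B (B.D e')) :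
    B.J₀.card ≤ 5 := by
  classical
  obtain ⟨-, hW, hr, hd₁, hd₂, hL, -, -, hG, hg₀, hgv, -, -, -, hG₁p, hcoef, hT3, hM0⟩ := id hD
  have he : e ∈ B.N := hG.1
  obtain ⟨hN, hne, he'N, hN2⟩ := N_eq_pair he hNe
  have hg₀J : g₀ ∉ B.J₀ := fun h => Finset.disjoint_left.1 hd₁ hg₀ h
  have hgu : u ∈ varSet I g₀ := by
    rcases hgv with ⟨-, h3⟩ | ⟨h2, -⟩
    · exact h3 ▸ vars_mem_varSet I g₀ 3
    · exact h2 ▸ vars_mem_varSet I g₀ 2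
  have he'D : e' ∉ B.D e' := fun h => (mem_sdiff.1 (hW.hD e' he'N h)).2 he'N
  have hDJ : B.D e' ⊆ B.J₀ := (hW.hD e' he'N).trans sdiff_subset
  have hDne : (B.D e').Nonempty := card_pos.1 (by have := two_le_card_of_even I hI hS he'D (hW.hDeven e' he'N); omega)
  obtain ⟨j₁, j₂, σ, τ, hj, hDe, hdisj, hσ, hτ, hform⟩ := hU
  have hστ : σ ≠ τ := ne_of_unit I hdisj hσ hτ
  have hj₁J : j₁ ∈ B.J₀ := hDJ (by rw [hDe]; exact mem_insert_self _ _)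
  have hj₂J : j₂ ∈ B.J₀ := hDJ (by rw [hDe]; exact mem_insert_of_mem (mem_singleton_self _))
  have hform' : ∀ v w : Fin n, polarDir I B (1, 0) (Pi.single v 1) (Pi.single w 1) =
      (if AndAdj I ({j₁, j₂} : Finset (Fin m)) v w then 1 else 0) + (if (v = σ ∧ w = τ) ∨ (v = τ ∧ w = σ) then 1 else 0) := by
    intro v w; rw [← hDe]; exact hform v w
  -- rank, (P1), (P3), the gadget
  have hrank := rank_four_of_unitCert I hI B hdisj hσ hτ hform'
  have hP1 : ∀ x, qDir I B (1, 0) x = 0 → qform (B.D e') (fun j => I.vars j 2) (fun j => I.vars j 3) x = gam B e' + 1 :=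
    fun x hx => (caseP_forced I hI hT hW hL hG hT3 hRA hread hx).1 e' he'N hne
  have hP3 := caseP_P3 I hI hT hW hL hG hN hne hT3 hRA hread
  obtain ⟨g, hg, hσg, hτg⟩ : ∃ g ∈ B.T₁ ∪ freeMon I B.N B.G₁ ∪ (B.T₂ ∪ freeMon I B.N B.G₂), σ ∈ andPair I g ∧ τ ∈ andPair I g := by
    refine exists_realiser_of_polarDir I hI hS B (1, 0) ?_
    rw [hform', if_neg, if_pos (Or.inl ⟨rfl, rfl⟩)]; · decide
    intro h
    obtain ⟨j, hj', hσj, hτj⟩ := mem_of_andAdj h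
    rw [mem_insert, mem_singleton] at hj'
    rcases hj' with rfl | rfl
    · exact Finset.disjoint_left.1 hdisj hτj hτ
    · exact Finset.disjoint_left.1 hdisj hσ hσj
  -- every private tree edge dies, whatever counted family `X ∋ g` contains `J₀ ∪ {g₀}`
  have main : ∀ X : Finset (Fin m), insert g₀ B.J₀ ⊆ X → g ∈ X →
      ∀ π ∈ B.J₀ \ B.N, (∀ j ∈ X, j ≠ π → I.vars π 2 ∉ varSet I j ∧ I.vars π 3 ∉ varSet I j) → False := by
    intro X hX hgX π hπ hpriv
    by_cases hπD : π ∈ B.D e'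
    · rw [hDe, mem_insert, mem_singleton] at hπD
      exact false_of_private_pair I hdisj hσ hτ hgX hσg hτg hπD hpriv
    · have hpriv' : ∀ j ∈ insert g₀ B.J₀, j ≠ π → I.vars π 2 ∉ varSet I j ∧ I.vars π 3 ∉ varSet I j :=
        fun j hj hne' => hpriv j (hX hj) hne'
      refine false_of_private_far I hI hT hS hW hd₁ hd₂ hG hg₀ hgu hG₁p hT3 hM0 hrank hcoef hP3 hDne hP1 hπ hpriv' fun s hs => ?_
      have havoid : ∀ j ∈ B.D e', I.vars j 2 ≠ I.vars π s ∧ I.vars j 3 ≠ I.vars π s := by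
        intro j hj'
        have hjπ : j ≠ π := fun h => hπD (h ▸ hj')
        obtain ⟨h2, h3⟩ := hpriv' j (mem_insert_of_mem (hDJ hj')) hjπ
        have : s = 2 ∨ s = 3 := by
          rcases s with ⟨s, hs4⟩
          simp only [Fin.ext_iff] at *
          omega
        rcases this with rfl | rfl
        · exact ⟨fun h => h2 (h ▸ vars_mem_varSet I j 2), fun h => h2 (h ▸ vars_mem_varSet I j 3)⟩
        · exact ⟨fun h => h3 (h ▸ vars_mem_varSet I j 2), fun h => h3 (h ▸ vars_mem_varSet I j 3)⟩
      have hvσ : I.vars π s ≠ σ := by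
        have h := havoid j₁ (by rw [hDe]; exact mem_insert_self _ _)
        rcases (mem_andPair_iff I j₁ σ).1 hσ with h' | h'
        · exact fun hh => h.1 (h'.symm.trans hh.symm)
        · exact fun hh => h.2 (h'.symm.trans hh.symm)
      have hvτ : I.vars π s ≠ τ := by
        have h := havoid j₂ (by rw [hDe]; exact mem_insert_of_mem (mem_singleton_self _))
        rcases (mem_andPair_iff I j₂ τ).1 hτ with h' | h'
        · exact fun hh => h.1 (h'.symm.trans hh.symm)
        · exact fun hh => h.2 (h'.symm.trans hh.symm)
      refine ⟨havoid, fun w => ?_⟩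
      rw [hform', if_neg, if_neg]
      · decide
      · rintro (⟨-, h⟩ | ⟨-, h⟩); exacts [hvτ h, hvσ h]
      · intro h
        obtain ⟨j, hj', -, hvj⟩ := mem_of_andAdj h
        rw [← hDe] at hj'
        rcases (mem_andPair_iff I j _).1 hvj with h' | h'
        · exact (havoid j hj').1 h'.symm
        · exact (havoid j hj').2 h'.symm
  -- count: `g` is a core member, or one cross gate
  by_cases hgJ : g ∈ B.J₀
  · refine (card_le_three_of_no_private I hB hD hN2 fun π hπ hpriv => ?_).trans (by norm_num)
    exact main (insert g₀ B.J₀) (Subset.refl _) (mem_insert_of_mem hgJ) π hπ hpriv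
  · have hgG : g ∈ freeMon I B.N B.G₁ ∪ freeMon I B.N B.G₂ := by
      rcases mem_union.1 hg with hg | hg <;> rcases mem_union.1 hg with hg | hg
      · exact absurd (mem_sdiff.1 (hW.hT₁ hg)).1 hgJ
      · exact mem_union_left _ hg
      · exact absurd (mem_sdiff.1 (hW.hT₂ hg)).1 hgJ
      · exact mem_union_right _ hg
    have hgG' : g ∈ B.G₁ ∪ B.G₂ := by
      rcases mem_union.1 hgG with h | h
      · exact mem_union_left _ (mem_filter.1 h).1
      · exact mem_union_right _ (mem_filter.1 h).1
    have hfree : ¬ (I.vars g 2 ∈ privs I B.N ∨ I.vars g 3 ∈ privs I B.N) := by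
      rcases mem_union.1 hgG with h | h
      · exact (mem_filter.1 h).2
      · exact (mem_filter.1 h).2
    have hgg : g ≠ g₀ := by
      intro h
      subst h
      have hp : I.vars e 2 ∈ privs I B.N := vars_mem_privs I he (s := 2) (by decide)
      rcases hgv with ⟨h2, -⟩ | ⟨-, h3⟩
      · exact hfree (Or.inl (h2 ▸ hp))
      · exact hfree (Or.inr (h3 ▸ hp))
    have hpair : andPair I g = {σ, τ} := andPair_eq_of_mem hσg hτg hστ
    have hold : (∃ j ∈ B.J₀, I.vars g 2 ∈ varSet I j) ∧ (∃ j ∈ B.J₀, I.vars g 3 ∈ varSet I j) := by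
      have hmem : ∀ v ∈ andPair I g, ∃ j ∈ B.J₀, v ∈ varSet I j := by
        intro v hv
        rw [hpair, mem_insert, mem_singleton] at hv
        rcases hv with rfl | rfl
        · exact ⟨j₁, hj₁J, andPair_subset_varSet I j₁ hσ⟩
        · exact ⟨j₂, hj₂J, andPair_subset_varSet I j₂ hτ⟩
      exact ⟨hmem _ ((mem_andPair_iff I g _).2 (Or.inl rfl)), hmem _ ((mem_andPair_iff I g _).2 (Or.inr rfl))⟩
    refine (card_le_four_of_cross I hB hD hN2 hgG' hgJ hgg hold fun π hπ hpriv => ?_).trans (by norm_num)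
    exact main (insert g (insert g₀ B.J₀)) (subset_insert _ _) (mem_insert_self _ _) π hπ hpriv

end Summit.PneNP.PneNP.Theorems.PstarGateCasePUnitsUnit
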